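import Summits.NavierStokesRegularity.NavierStokesRegularity.Theorems.TypeICertificateLadderTargetRssCompactness
import Summits.NavierStokesRegularity.NavierStokesRegularity.Theorems.TypeICertificateLadderTargetRssStratumAxisymmetric
import Summits.NavierStokesRegularity.NavierStokesRegularity.Theorems.TypeICertificateLadderTargetRssStratumForwardUnique
import Summits.NavierStokesRegularity.NavierStokesRegularity.Theorems.TypeICertificateLadderTargetRssStratumTwoSpeeds
import Literature.Analysis.FluidPDE.AxisymmetricReflection
import Literature.Analysis.FluidPDE.IsometryInvariance
import HarnessLib

/-!
# Crux `Target` (stmt-NavierStokesRegularity-1217), line `killing-twisted-bernoulli-solitons`,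
  stub B5b `stub_windowLiouville`: the MIRROR STRATUM — bilaterally symmetric Type-I rotating
  solitons do not exist

Support file (theorems only, `--supports stmt-NavierStokesRegularity-1217`), registered sub-goal
`rssStratum_mirror` of the c2 lead.

**Theorem (`rssStratum_mirror`).** Let `(u, p)` be a classical Navier–Stokes solution on
`ℝ³ × [−1, 0)` with the Type-I bound `‖u(t,x)‖ ≤ C₀/(‖x‖ + √−t)` which is rotated self-similar
with speed `α ≠ 0` and a `C²` profile `U` (`u = pvAnsatz α U`, Pineau–Vicol (1.7)). If `U` is
symmetric under the reflection `σ` in a meridian plane (`U(σy) = σ U(y)`, `σ = reflY`: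
`(y₀, y₁, y₂) ↦ (y₀, −y₁, y₂)`), then `U = 0`.

So a counterexample to Pineau–Vicol's Conjecture 1.1 in the window must be CHIRAL with respect
to every meridian plane — a new necessary condition, complementary to the quantitative
non-axisymmetry of the rotation-defect stratum (`rotationDefect_liouville`) and to the
co-rotation / pressure-torque conditions of the soliton identity.

More generally (`rssStratum_reversing`) the same holds for equivariance under ANY linear isometry
`g` with `g R(θ) g⁻¹ = R(−θ)` (meridian mirrors `σ_φ = R_φ σ R_{−φ}` — `rssStratum_mirror_plane` —,
rotations by `π` about horizontal axes, …).

Proof. The reflection conjugates the rotations about the axis, `σ R(θ) σ = R(−θ)`, hence maps the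
RSS ansatz of speed `α` and profile `U` to the RSS ansatz of speed `−α` and profile `σUσ = U`
(mirror symmetry); by the reflection covariance of Navier–Stokes both are Type-I classical
solutions of Pineau–Vicol's class, and both extend backwards to classical Type-I solutions on
`t < 0` (`rssCompact_extend`). They have the SAME slice `U` at `t = −1`, so by forward uniqueness in
the Type-I ancient class (`rssStratum_typeI_forward_unique`: KNSS mildness + uniqueness of bounded
solutions of the Oseen integral equation) they agree on `t ∈ (−1, −1/2)`; equality of the ansatz
fields of one profile at the two different speeds `α ≠ −α` forces `U` to be equivariant under the
rotations by all angles `2αs`, `s ∈ (0, log 2)`, hence under all rotations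
(`rssStratum_axisymmetric_of_two_speeds`); and axisymmetric Type-I RSS profiles are trivial by
KNSS 2009, Thm. 5.3 (`rssStratum_axisymmetric`).

## References

* B. Pineau, V. Vicol, arXiv:2607.09619 (2026): Conj. 1.1, §1.2 (1.6)–(1.10) and p. 5 (`ker R`).
  [PineauVicol2026]
* G. Koch, N. Nadirashvili, G. Seregin, V. Šverák, Acta Math. 203 (2009), Thm. 5.3, Thm. 6.1.
  [KochNadirashviliSereginSverak2009]
* A. Majda, A. Bertozzi, *Vorticity and incompressible flow* (CUP 2002), §1.2 Prop. 1.1 (iii)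
  (symmetry covariance). [MajdaBertozziCUP2002]
-/

noncomputable section

namespace Summit.NavierStokesRegularity.NavierStokesRegularity.Theorems

open MeasureTheory Set Function Filter Metric Real
open scoped Topology ContDiff
open Literature.Analysis.FluidPDE Literature.Analysis.FluidPDE.PineauVicol2026

/-! ### Speed-reversing symmetries: `g R(θ) g⁻¹ = R(−θ)` -/

/-- If a linear isometry `g` conjugates the rotations about the axis to their inverses,
`g (R_θ z) = R_{−θ} (g z)`, then so does `g⁻¹`. [folklore] -/
theorem rssStratum_symm_conj {g : EuclideanSpace ℝ (Fin 3) ≃ₗᵢ[ℝ] EuclideanSpace ℝ (Fin 3)}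
    (hg : ∀ (θ : ℝ) (z : EuclideanSpace ℝ (Fin 3)), g (rotZ θ z) = rotZ (-θ) (g z))
    (θ : ℝ) (z : EuclideanSpace ℝ (Fin 3)) : g.symm (rotZ θ z) = rotZ (-θ) (g.symm z) := by
  apply g.injective
  rw [g.apply_symm_apply, hg, neg_neg, g.apply_symm_apply]

/-- **The conjugate ansatz.** If `g` conjugates the rotations about the axis to their inverses,
then conjugating the RSS ansatz field of speed `α` and profile `U` by `g` gives the RSS ansatz field
of speed `−α` and profile `g ∘ U ∘ g⁻¹`: `g (pvAnsatz α U t (g⁻¹ x)) = pvAnsatz (−α) (gUg⁻¹) t x`.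
(Examples of such `g`: the reflection `σ` in a meridian plane, `σ_φ = R_φ σ R_{−φ}`, the rotation by
`π` about a horizontal axis.) [cite: PineauVicol2026, §1.2 (1.6)–(1.7)] -/
theorem rssStratum_conj_pvAnsatz {g : EuclideanSpace ℝ (Fin 3) ≃ₗᵢ[ℝ] EuclideanSpace ℝ (Fin 3)}
    (hg : ∀ (θ : ℝ) (z : EuclideanSpace ℝ (Fin 3)), g (rotZ θ z) = rotZ (-θ) (g z))
    (α : ℝ) (U : EuclideanSpace ℝ (Fin 3) → EuclideanSpace ℝ (Fin 3)) (t : ℝ) (x : EuclideanSpace ℝ (Fin 3)) :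
    g (pvAnsatz α (fun y _ => U y) t (g.symm x)) =
      pvAnsatz (-α) (fun y _ => g (U (g.symm y))) t x := by
  simp only [pvAnsatz, LinearIsometryEquiv.map_smul, hg, rssStratum_symm_conj hg, neg_mul, neg_neg]

/-- **Covariance of Pineau–Vicol's class under a speed-reversing symmetry.** If `(u, p)` is a
classical solution on `[−1, 0)` with the Type-I bound (constant `C₀`) which is the RSS ansatz of
speed `α` and profile `U` there, and `g` conjugates the rotations about the axis to their inverses,
then `(gug⁻¹, p∘g⁻¹)` is a classical solution on `[−1, 0)` with the same Type-I bound which is the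
RSS ansatz of speed `−α` and profile `gUg⁻¹`. [cite: MajdaBertozziCUP2002, §1.2 Prop. 1.1 (iii); PineauVicol2026, §1.2 (1.7)] -/
theorem rssStratum_conj_class {α C₀ : ℝ} {g : EuclideanSpace ℝ (Fin 3) ≃ₗᵢ[ℝ] EuclideanSpace ℝ (Fin 3)}
    (hg : ∀ (θ : ℝ) (z : EuclideanSpace ℝ (Fin 3)), g (rotZ θ z) = rotZ (-θ) (g z))
    {u : ℝ → EuclideanSpace ℝ (Fin 3) → EuclideanSpace ℝ (Fin 3)} {p : ℝ → EuclideanSpace ℝ (Fin 3) → ℝ}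
    {U : EuclideanSpace ℝ (Fin 3) → EuclideanSpace ℝ (Fin 3)}
    (hsol : IsClassicalNSSolutionOn (Ico (-1) 0) 1 0 u p)
    (hI : ∀ t ∈ Ico (-1 : ℝ) 0, ∀ x : EuclideanSpace ℝ (Fin 3), ‖u t x‖ ≤ C₀ / (‖x‖ + Real.sqrt (-t)))
    (hans : ∀ t ∈ Ico (-1 : ℝ) 0, ∀ x : EuclideanSpace ℝ (Fin 3), u t x = pvAnsatz α (fun y _ => U y) t x) :
    IsClassicalNSSolutionOn (Ico (-1) 0) 1 0 (fun t x => g (u t (g.symm x)))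
        (fun t x => p t (g.symm x)) ∧
      (∀ t ∈ Ico (-1 : ℝ) 0, ∀ x : EuclideanSpace ℝ (Fin 3),
        ‖g (u t (g.symm x))‖ ≤ C₀ / (‖x‖ + Real.sqrt (-t))) ∧
      (∀ t ∈ Ico (-1 : ℝ) 0, ∀ x : EuclideanSpace ℝ (Fin 3),
        g (u t (g.symm x)) = pvAnsatz (-α) (fun y _ => g (U (g.symm y))) t x) := by
  refine ⟨?_, fun t ht x => ?_, fun t ht x => ?_⟩
  · have h1 := hsol.conj_linearIsometryEquiv (R := g) (uniqueDiffOn_Ico (-1) 0)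
    have hf : (fun t x => g ((0 : ℝ → EuclideanSpace ℝ (Fin 3) → EuclideanSpace ℝ (Fin 3)) t
        (g.symm x))) = 0 := by
      funext t x; simp
    rw [hf] at h1
    exact h1
  · rw [LinearIsometryEquiv.norm_map]
    have h := hI t ht (g.symm x)
    rwa [LinearIsometryEquiv.norm_map] at h
  · rw [hans t ht (g.symm x)]
    exact rssStratum_conj_pvAnsatz hg α U t x

/-- **THE REVERSING-SYMMETRY STRATUM.** A Type-I rotated self-similar classical solution of
Pineau–Vicol's class with speed `α ≠ 0` whose profile is equivariant, `U(gy) = gU(y)`, under SOME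
linear isometry `g` of `ℝ³` conjugating the rotations about the axis to their inverses
(`g R_θ g⁻¹ = R_{−θ}`: reflections in meridian planes, rotations by `π` about horizontal axes, …) is
trivial. Proof: `g` turns `u` into a solution of the class with speed `−α` and the SAME profile;
both extend backwards to classical Type-I solutions on `t < 0` (`rssCompact_extend`) with the same
slice `U` at `t = −1`; forward uniqueness (`rssStratum_typeI_forward_unique`) makes them agree on
`(−1, −1/2)`; two different speeds force axisymmetry (`rssStratum_axisymmetric_of_two_speeds`); and
axisymmetric Type-I RSS profiles are trivial (`rssStratum_axisymmetric`, KNSS 2009 Thm. 5.3). New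
relative to the source (which settles `ker R` and the extreme speeds only). [cite: PineauVicol2026, Conj. 1.1 and p. 5; KochNadirashviliSereginSverak2009, Thm. 5.3 and Thm. 6.1] -/
theorem rssStratum_reversing {C₀ α : ℝ} (hα : α ≠ 0)
    {g : EuclideanSpace ℝ (Fin 3) ≃ₗᵢ[ℝ] EuclideanSpace ℝ (Fin 3)}
    (hg : ∀ (θ : ℝ) (z : EuclideanSpace ℝ (Fin 3)), g (rotZ θ z) = rotZ (-θ) (g z))
    {u : ℝ → EuclideanSpace ℝ (Fin 3) → EuclideanSpace ℝ (Fin 3)} {p : ℝ → EuclideanSpace ℝ (Fin 3) → ℝ}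
    {U : EuclideanSpace ℝ (Fin 3) → EuclideanSpace ℝ (Fin 3)}
    (hsol : IsClassicalNSSolutionOn (Ico (-1) 0) 1 0 u p)
    (hI : ∀ t ∈ Ico (-1 : ℝ) 0, ∀ x : EuclideanSpace ℝ (Fin 3), ‖u t x‖ ≤ C₀ / (‖x‖ + Real.sqrt (-t)))
    (hU2 : ContDiff ℝ 2 U)
    (hans : ∀ t ∈ Ico (-1 : ℝ) 0, ∀ x : EuclideanSpace ℝ (Fin 3), u t x = pvAnsatz α (fun y _ => U y) t x)
    (hsymm : ∀ y : EuclideanSpace ℝ (Fin 3), U (g y) = g (U y)) : U = 0 := by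
  -- the `g`-equivariant profile is its own conjugate
  have hUU : (fun (y : EuclideanSpace ℝ (Fin 3)) (_ : ℝ) => g (U (g.symm y))) = fun y _ => U y := by
    funext y s
    have h := hsymm (g.symm y)
    rw [g.apply_symm_apply] at h
    exact h.symm
  -- the conjugate solution: speed `-α`, same profile
  obtain ⟨hsol', hI', hans'⟩ := rssStratum_conj_class hg hsol hI hans
  rw [hUU] at hans'
  -- backward extensions of both, with the same Type-I constant
  obtain ⟨⟨P, hP⟩, hIw⟩ := rssCompact_extend hsol hI hans
  obtain ⟨⟨Q, hQ⟩, hIw'⟩ := rssCompact_extend hsol' hI' hans'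
  -- the same slice at `t = -1`
  have hslice : pvAnsatz α (fun y _ => U y) (-1) = pvAnsatz (-α) (fun y _ => U y) (-1) := by
    funext x; rw [pvAnsatz_neg_one, pvAnsatz_neg_one]
  -- forward uniqueness on `(-1, -1/2)`
  have heq := rssStratum_typeI_forward_unique C₀ _ _ P Q hP hQ hIw hIw' hslice
  -- two different speeds: axisymmetry
  have hne : α ≠ -α := fun h => hα (by linarith)
  have hax : IsAxisymmetric U :=
    rssStratum_axisymmetric_of_two_speeds α (-α) U hne fun t ht x => congr_fun (heq t ht) x
  -- KNSS Thm 5.3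
  exact rssStratum_axisymmetric C₀ α u p U hsol hI hU2 hans hax

/-! ### The meridian reflection `σ = reflY` -/

/-- The meridian reflection conjugates the rotations about the axis to their inverses:
`σ (R_θ z) = R_{−θ} (σ z)`. [cite: MajdaBertozziCUP2002, §2.3.3] -/
theorem rssStratum_reflY_rotZ (θ : ℝ) (z : EuclideanSpace ℝ (Fin 3)) :
    reflY (rotZ θ z) = rotZ (-θ) (reflY z) := by
  ext i
  fin_cases i
  · simp [reflY, rotZ, Real.cos_neg, Real.sin_neg]
  · simp [reflY, rotZ, Real.cos_neg, Real.sin_neg]; ring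
  · simp [reflY, rotZ]

/-- **THE MIRROR STRATUM (registered sub-goal `rssStratum_mirror`).** A Type-I rotated
self-similar classical solution of Pineau–Vicol's class with speed `α ≠ 0` whose profile is
symmetric under the reflection in a meridian plane, `U(σy) = σU(y)`, is trivial: `U = 0`
(`rssStratum_reversing` with `g = σ`). So a window counterexample to Conj. 1.1 is CHIRAL. [cite: PineauVicol2026, Conj. 1.1 and p. 5; KochNadirashviliSereginSverak2009, Thm. 5.3 and Thm. 6.1] -/
theorem rssStratum_mirror :
    ∀ (C₀ α : ℝ), α ≠ 0 → ∀ (u : ℝ → EuclideanSpace ℝ (Fin 3) → EuclideanSpace ℝ (Fin 3)) (p : ℝ → EuclideanSpace ℝ (Fin 3) → ℝ) (U : EuclideanSpace ℝ (Fin 3) → EuclideanSpace ℝ (Fin 3)), Literature.Analysis.FluidPDE.IsClassicalNSSolutionOn (Set.Ico (-1) 0) 1 0 u p → (∀ t ∈ Set.Ico (-1 : ℝ) 0, ∀ x : EuclideanSpace ℝ (Fin 3), ‖u t x‖ ≤ C₀ / (‖x‖ + Real.sqrt (-t))) → ContDiff ℝ 2 U → (∀ t ∈ Set.Ico (-1 :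 ℝ) 0, ∀ x : EuclideanSpace ℝ (Fin 3), u t x = Literature.Analysis.FluidPDE.pvAnsatz α (fun y _ => U y) t x) → (∀ y : EuclideanSpace ℝ (Fin 3), U (Literature.Analysis.FluidPDE.reflY y) = Literature.Analysis.FluidPDE.reflY (U y)) → U = 0 := by
  intro C₀ α hα u p U hsol hI hU2 hans hmirror
  exact rssStratum_reversing hα rssStratum_reflY_rotZ hsol hI hU2 hans hmirror

/-! ### Any meridian plane: conjugation by a rotation about the axis -/

/-- Rotations about the same axis commute. [folklore] -/
private theorem mirror_rotZ_comm (θ φ : ℝ) (z : EuclideanSpace ℝ (Fin 3)) :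
    rotZ θ (rotZ φ z) = rotZ φ (rotZ θ z) := by
  rw [← rotZ_add, add_comm, rotZ_add]

/-- **Rotation covariance of the ansatz (same axis).** Conjugating the RSS ansatz field of speed
`α` and profile `U` by the rotation `R_{−φ}` about the axis gives the RSS ansatz field of the SAME
speed and the conjugate profile: `R_{−φ} (pvAnsatz α U t (R_φ x)) = pvAnsatz α (R_{−φ}UR_φ) t x`. [cite: PineauVicol2026, §1.2 (1.6)–(1.7)] -/
theorem rssStratum_rotZ_pvAnsatz (α φ : ℝ) (U : EuclideanSpace ℝ (Fin 3) → EuclideanSpace ℝ (Fin 3))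
    (t : ℝ) (x : EuclideanSpace ℝ (Fin 3)) :
    rotZ (-φ) (pvAnsatz α (fun y _ => U y) t (rotZ φ x)) =
      pvAnsatz α (fun y _ => rotZ (-φ) (U (rotZ φ y))) t x := by
  have e2 : ∀ (θ c : ℝ) (z : EuclideanSpace ℝ (Fin 3)), rotZ θ (c • z) = c • rotZ θ z :=
    fun θ c z => by rw [← rotZL_apply, map_smul, rotZL_apply]
  simp only [pvAnsatz]
  rw [← e2 φ, mirror_rotZ_comm (-(α * -Real.log (-t))) φ, e2 (-φ),
    mirror_rotZ_comm (-φ) (α * -Real.log (-t))]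

/-- **THE MIRROR STRATUM for an arbitrary meridian plane.** A Type-I rotated self-similar
classical solution of Pineau–Vicol's class with speed `α ≠ 0` whose profile is symmetric under
the reflection `σ_φ = R_φ σ R_{−φ}` in ANY meridian plane is trivial. (Conjugate by `R_{−φ}`: the
profile `R_{−φ} U R_φ` is `σ`-symmetric and, by the rotation covariance of Navier–Stokes and of the
ansatz, again the profile of a solution of the class with the same speed; apply
`rssStratum_mirror`.) [cite: PineauVicol2026, Conj. 1.1 and p. 5; MajdaBertozziCUP2002, §1.2 Prop. 1.1 (iii)] -/
theorem rssStratum_mirror_plane {C₀ α : ℝ} (hα : α ≠ 0) (φ : ℝ)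
    {u : ℝ → EuclideanSpace ℝ (Fin 3) → EuclideanSpace ℝ (Fin 3)} {p : ℝ → EuclideanSpace ℝ (Fin 3) → ℝ}
    {U : EuclideanSpace ℝ (Fin 3) → EuclideanSpace ℝ (Fin 3)}
    (hsol : IsClassicalNSSolutionOn (Ico (-1) 0) 1 0 u p)
    (hI : ∀ t ∈ Ico (-1 : ℝ) 0, ∀ x : EuclideanSpace ℝ (Fin 3), ‖u t x‖ ≤ C₀ / (‖x‖ + Real.sqrt (-t)))
    (hU2 : ContDiff ℝ 2 U)
    (hans : ∀ t ∈ Ico (-1 : ℝ) 0, ∀ x : EuclideanSpace ℝ (Fin 3), u t x = pvAnsatz α (fun y _ => U y) t x)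
    (hmirror : ∀ y : EuclideanSpace ℝ (Fin 3),
      U (rotZ φ (reflY (rotZ (-φ) y))) = rotZ φ (reflY (rotZ (-φ) (U y)))) :
    U = 0 := by
  -- the conjugate profile and solution
  set R : EuclideanSpace ℝ (Fin 3) ≃ₗᵢ[ℝ] EuclideanSpace ℝ (Fin 3) := rotZLIE (-φ) with hR
  set U' : EuclideanSpace ℝ (Fin 3) → EuclideanSpace ℝ (Fin 3) := fun y => rotZ (-φ) (U (rotZ φ y))
    with hU'
  have hsol' : IsClassicalNSSolutionOn (Ico (-1) 0) 1 0 (fun t x => R (u t (R.symm x)))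
      (fun t x => p t (R.symm x)) := by
    have h1 := hsol.conj_linearIsometryEquiv (R := R) (uniqueDiffOn_Ico (-1) 0)
    have hf : (fun t x => R ((0 : ℝ → EuclideanSpace ℝ (Fin 3) → EuclideanSpace ℝ (Fin 3)) t
        (R.symm x))) = 0 := by
      funext t x; simp
    rw [hf] at h1
    exact h1
  have hI' : ∀ t ∈ Ico (-1 : ℝ) 0, ∀ x : EuclideanSpace ℝ (Fin 3),
      ‖R (u t (R.symm x))‖ ≤ C₀ / (‖x‖ + Real.sqrt (-t)) := by
    intro t ht x
    rw [LinearIsometryEquiv.norm_map]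
    have h := hI t ht (R.symm x)
    rwa [LinearIsometryEquiv.norm_map] at h
  have hans' : ∀ t ∈ Ico (-1 : ℝ) 0, ∀ x : EuclideanSpace ℝ (Fin 3),
      R (u t (R.symm x)) = pvAnsatz α (fun y _ => U' y) t x := by
    intro t ht x
    simp only [hR, rotZLIE_apply, rotZLIE_symm_apply, neg_neg]
    rw [hans t ht (rotZ φ x)]
    exact rssStratum_rotZ_pvAnsatz α φ U t x
  have hU2' : ContDiff ℝ 2 U' := by
    have e : U' = fun y => rotZL (-φ) (U (rotZL φ y)) := rfl
    rw [e]
    exact (rotZL (-φ)).contDiff.comp (hU2.comp (rotZL φ).contDiff)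
  -- the conjugate profile is `σ`-symmetric
  have hmirror' : ∀ y : EuclideanSpace ℝ (Fin 3), U' (reflY y) = reflY (U' y) := by
    intro y
    simp only [hU']
    have h := hmirror (rotZ φ y)
    rw [← rotZ_add, neg_add_cancel, rotZ_zero] at h
    rw [h, ← rotZ_add, neg_add_cancel, rotZ_zero]
  have hzero := rssStratum_mirror C₀ α hα _ _ U' hsol' hI' hU2' hans' hmirror'
  -- undo the conjugation
  funext y
  have h := congr_fun hzero (rotZ (-φ) y)
  simp only [hU', Pi.zero_apply, ← rotZ_add, add_neg_cancel, rotZ_zero] at h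
  have h2 := congrArg (rotZ φ) h
  rw [← rotZ_add, add_neg_cancel, rotZ_zero] at h2
  rw [h2, Pi.zero_apply, ← rotZL_apply, map_zero]

end Summit.NavierStokesRegularity.NavierStokesRegularity.Theorems

end
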